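import Summits.CriticalPhenomena.PercolationContinuityZ3.Theorems.PercNearOneGluingNoHeavyLowerTailSahiHardCoreReduction
import HarnessLib

/-!
# `NoHeavyLowerTail` (stmt-CriticalPhenomena-4575) — triplewise meet containment / hard-core reduction for DECREASING events (percolation separations)

Support file, seat `prim-l12-p5` (gen 4), `--supports stmt-CriticalPhenomena-4575`.  No definitions, no named facts, no sorries.
Order reversal of the product-measure corollaries of `…SahiHereditaryMeetAbsorption` (Theorem F) and `…SahiHardCoreReduction` (Theorem H): decreasing
events of `2^ι` are increasing on the order dual, whose product weight `bernoulliWeightDual p` is again FKG (`isFKGMeasure_bernoulliWeightDual`), and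
Sahi's functional of the dual indicator family is literally the same number (cf. `sahiE3_nonneg_of_sahiPositive_lower` in
`Literature/…/Sahi2008/Percolation.lean`).  The separation events `{X ↮ Y}` of bond percolation — the slots of the one-cut programme's `E3GRP` rows —
are decreasing, so:

* `bernoulliWeight_sahiE_ind_nonneg_of_triplewise_lower` — decreasing events among any three of which one contains the intersection of the other two
  (e.g. any family of separations `{X_i ↮ Y_i}` with a common "core" separation contained in all pairwise intersections) have `E_m ≥ 0` at every
  order under every product measure;
* `bernoulliWeight_sahiE_ind_nonneg_of_hardCore_of_fourwise_lower` — for decreasing events, `E_m ≥ 0` follows from `sahiE3 ≥ 0` on the hard-core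
  sub-triples plus fourwise absorption.
-/

namespace Summit.CriticalPhenomena.PercolationContinuityZ3.Theorems

namespace SahiHereditaryMeetAbsorption

open Finset Function Literature.Combinatorics.Sahi2008 SahiMomentExpansion SahiDefectExpansion
open scoped Nat

/-! ### Decreasing events (order reversal): separation events of percolation are lower sets -/

section Lower

open Literature.Probability.Percolation.DecisionTree (ind ind_of_mem ind_of_not_mem ind_nonneg)
open Literature.Probability.LatticeModels (prodBernoulli sahiE3)

/-- **Product measures, DECREASING events, triplewise meet containment**: for `p ∈ [0,1]^ι` and decreasing events `A_0,…,A_{m−1} ⊆ 2^ι`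
(e.g. separation events `{X ↮ Y}` of bond percolation) such that among any three one contains the intersection of the other two,
`E_m(1_{A_0},…,1_{A_{m−1}}) ≥ 0` under `bernoulliWeight p` (Theorem F on the order dual `(Set ι)ᵒᵈ`, weight `bernoulliWeightDual p`). [this file] -/
theorem bernoulliWeight_sahiE_ind_nonneg_of_triplewise_lower {ι : Type*} [Fintype ι] (p : ι → unitInterval) (m : ℕ)
    (A : Fin m → Set (Set ι)) (hA : ∀ i, IsLowerSet (A i))
    (htri : ∀ i j k : Fin m, i ≠ j → i ≠ k → j ≠ k → A j ∩ A k ⊆ A i ∨ A i ∩ A k ⊆ A j ∨ A i ∩ A j ⊆ A k) :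
    0 ≤ sahiE (bernoulliWeight p) m (fun i => ind (A i)) := by
  have key := sahiE_nonneg_of_triplewise_meetContainment (isFKGMeasure_bernoulliWeightDual p) m
    (fun i (a : (Set ι)ᵒᵈ) => ind (A i) (OrderDual.ofDual a)) (fun i a => ?_)
    (fun i => monotone_ind_toDual_of_isLowerSet (hA i)) fun S hS => ?_
  · exact key
  · by_cases h : OrderDual.ofDual a ∈ A i
    · exact Or.inr (ind_of_mem h)
    · exact Or.inl (ind_of_not_mem h)
  · obtain ⟨q, hq, habs⟩ : ∃ q ∈ S, ∀ ω, (∀ i ∈ S.erase q, ω ∈ A i) → ω ∈ A q := by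
      obtain ⟨i, j, k, hij, hik, hjk, rfl⟩ := Finset.card_eq_three.mp hS
      rcases htri i j k hij hik hjk with h | h | h
      · exact ⟨i, by simp, fun ω hω => h ⟨hω j (Finset.mem_erase.mpr ⟨hij.symm, by simp⟩),
          hω k (Finset.mem_erase.mpr ⟨hik.symm, by simp⟩)⟩⟩
      · exact ⟨j, by simp, fun ω hω => h ⟨hω i (Finset.mem_erase.mpr ⟨hij, by simp⟩),
          hω k (Finset.mem_erase.mpr ⟨hjk.symm, by simp⟩)⟩⟩
      · exact ⟨k, by simp, fun ω hω => h ⟨hω i (Finset.mem_erase.mpr ⟨hik, by simp⟩),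
          hω j (Finset.mem_erase.mpr ⟨hjk, by simp⟩)⟩⟩
    obtain ⟨q', hq', h'⟩ := exists_absorber_ind A S ⟨q, hq, habs⟩
    exact ⟨q', hq', fun a => h' (OrderDual.ofDual a)⟩

/-- **Reduction to the hard core, DECREASING events**: product measure, decreasing events `A_0,…,A_{m−1}`; if every hard-core sub-triple `i < j < k`
has `sahiE3 (prodBernoulli p) (A_i) (A_j) (A_k) ≥ 0` and among any four events one contains the intersection of the other three, then
`E_m(1_{A_0},…,1_{A_{m−1}}) ≥ 0`. [this file] -/
theorem bernoulliWeight_sahiE_ind_nonneg_of_hardCore_of_fourwise_lower {ι : Type*} [Fintype ι] (p : ι → unitInterval) (m : ℕ)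
    (A : Fin m → Set (Set ι)) (hA : ∀ i, IsLowerSet (A i))
    (hcore : ∀ i j k : Fin m, i < j → j < k → ¬ (A j ∩ A k ⊆ A i) → ¬ (A i ∩ A k ⊆ A j) → ¬ (A i ∩ A j ⊆ A k) →
      0 ≤ sahiE3 (prodBernoulli p) (A i) (A j) (A k))
    (h4 : ∀ S : Finset (Fin m), S.card = 4 → ∃ q ∈ S, ∀ ω, (∀ i ∈ S.erase q, ω ∈ A i) → ω ∈ A q) :
    0 ≤ sahiE (bernoulliWeight p) m (fun i => ind (A i)) := by
  have hind : ∀ (X Y Z : Set (Set ι)), (∀ ω, ind X ω * ind Y ω ≤ ind Z ω) ↔ X ∩ Y ⊆ Z := by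
    intro X Y Z
    constructor
    · intro h ω ⟨hX, hY⟩
      have := h ω
      rw [ind_of_mem hX, ind_of_mem hY, one_mul] at this
      by_contra hZ
      rw [ind_of_not_mem hZ] at this
      exact absurd this (by norm_num)
    · intro h ω
      by_cases hX : ω ∈ X
      · by_cases hY : ω ∈ Y
        · rw [ind_of_mem hX, ind_of_mem hY, ind_of_mem (h ⟨hX, hY⟩), one_mul]
        · rw [ind_of_not_mem hY, mul_zero]; exact ind_nonneg _ _
      · rw [ind_of_not_mem hX, zero_mul]; exact ind_nonneg _ _
  have key := sahiE_nonneg_of_hardCore_of_fourwise (isFKGMeasure_bernoulliWeightDual p) m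
    (fun i (a : (Set ι)ᵒᵈ) => ind (A i) (OrderDual.ofDual a)) (fun i a => ?_)
    (fun i => monotone_ind_toDual_of_isLowerSet (hA i)) (fun i j k hij hjk ha hb hc => ?_) fun S hS => ?_
  · exact key
  · by_cases h : OrderDual.ofDual a ∈ A i
    · exact Or.inr (ind_of_mem h)
    · exact Or.inl (ind_of_not_mem h)
  · have e : sahiE (bernoulliWeightDual p) 3 ![fun a => ind (A i) (OrderDual.ofDual a), fun a => ind (A j) (OrderDual.ofDual a),
        fun a => ind (A k) (OrderDual.ofDual a)] = sahiE3 (prodBernoulli p) (A i) (A j) (A k) := sahiE_three_ind p (A i) (A j) (A k)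
    rw [e]
    exact hcore i j k hij hjk (fun h => ha fun a => (hind _ _ _).mpr h (OrderDual.ofDual a))
      (fun h => hb fun a => (hind _ _ _).mpr h (OrderDual.ofDual a)) (fun h => hc fun a => (hind _ _ _).mpr h (OrderDual.ofDual a))
  · obtain ⟨q', hq', h'⟩ := exists_absorber_ind A S (h4 S hS)
    exact ⟨q', hq', fun a => h' (OrderDual.ofDual a)⟩

end Lower

end SahiHereditaryMeetAbsorption

end Summit.CriticalPhenomena.PercolationContinuityZ3.Theorems
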